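import Mathlib

/-!
# The one-prime face of abc at primes of bounded index (solo-ABC-informed, session 3)

Write `W(p) = v_p(2^(p-1) - 1)` (the Wieferich exponent of the prime `p` to base 2) and
`e_p = ord_p 2`.  The abc conjecture, restricted to the Mersenne triples `(1, 2^n - 1, 2^n)` and read at
a single prime, says (`SoloInformedOnePrime.lean`, `soloInformed_onePrime_of_abc`):
for every `ε > 0` there is `K` with `(W(p) - 1)·log p ≤ ε·e_p·log 2 + K` for all primes `p`.

Literature input (NOT reproduced here, taken as an inline hypothesis of the same SHAPE):
T. Yamada, *A note on the paper by Bugeaud and Laurent "Minoration effective de la distance p-adique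
entre puissances de nombres algébriques"*, J. Number Theory 130 (2010) 1889–1897 (arXiv:math/0607072),
Theorem 1.2: for every prime `p`,
  `v_p(2^(p-1) - 1) ≤ ⌊283 (p-1) (log 3 / log p) (log 6 / log p)⌋ + 4 < 557.2·p/(log p)^2 + 4`,
obtained from Bugeaud–Laurent's bound for two p-adic logarithms (interpolation determinants).

This file proves the elementary consequence: ANY bound of Yamada's shape
`W(p) ≤ A·p/(log p)^2 + A'` implies the abc prediction above — indeed the stronger
`W(p)·log p ≤ ε·e_p·log 2 + K` — on every set of primes of bounded index `p ≤ I·e_p`.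
So the one-prime face of abc is open only at primes where 2 generates a subgroup of `(ℤ/p)ˣ`
of large index; this is the one-prime form of the `p`-factor in p-adic linear forms in logarithms.
No new mathematics is claimed: the theorem types where the literature stands.
-/

namespace Summit.ABC.ABC.Theorems

/-- **Bounded index: a two-logarithm bound of Yamada's shape settles the one-prime abc prediction.**
If `W(p) = v_p(2^(p-1)-1) ≤ A·p/(log p)^2 + A'` for all odd primes `p` (Yamada 2010, Thm 1.2, gives
`A = 557.2`, `A' = 4`), then for every `I > 0` and `ε > 0` there is `K` such that
`W(p)·log p ≤ ε·e_p·log 2 + K` for every odd prime `p` with `p ≤ I·e_p`, where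
`e_p = orderOf (2 : ZMod p)`. -/
theorem soloInformed_onePrime_boundedIndex_of_twoLogBound {A A' : ℝ} (hA : 0 ≤ A) (hA' : 0 ≤ A')
    (hY : ∀ p : ℕ, p.Prime → p ≠ 2 →
      (padicValNat p (2 ^ (p - 1) - 1) : ℝ) ≤ A * p / (Real.log p) ^ 2 + A')
    {I : ℝ} (hI : 0 < I) {ε : ℝ} (hε : 0 < ε) :
    ∃ K : ℝ, ∀ p : ℕ, p.Prime → p ≠ 2 → (p : ℝ) ≤ I * (orderOf (2 : ZMod p) : ℝ) →
      (padicValNat p (2 ^ (p - 1) - 1) : ℝ) * Real.log p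
        ≤ ε * (orderOf (2 : ZMod p) : ℝ) * Real.log 2 + K := by
  have hlog2 : 0 < Real.log 2 := Real.log_pos one_lt_two
  -- the slope that the index bound allows: c·p ≤ ε·e_p·log 2 whenever p ≤ I·e_p
  set c : ℝ := ε * Real.log 2 / I with hc_def
  have hc : 0 < c := by positivity
  -- threshold beyond which A/log p ≤ c/2
  set P0 : ℝ := Real.exp (2 * A / c) with hP0_def
  have hP0 : 0 < P0 := Real.exp_pos _
  -- auxiliary scale for log p ≤ d·p - 1 - log d
  set d : ℝ := c / (2 * (A' + 1)) with hd_def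
  have hd : 0 < d := by positivity
  refine ⟨A * P0 / Real.log 2 + (A' + 1) * (-1 - Real.log d), ?_⟩
  intro p hp hp2 hidx
  have hp3nat : 3 ≤ p := by have := hp.two_le; omega
  have hp3 : (3 : ℝ) ≤ p := by exact_mod_cast hp3nat
  have hp_pos : (0 : ℝ) < p := by linarith
  have hL2 : Real.log 2 ≤ Real.log p := Real.log_le_log two_pos (by linarith)
  have hL : 0 < Real.log p := lt_of_lt_of_le hlog2 hL2
  -- Step 0: from the two-logarithm bound, W·log p ≤ A·p/log p + A'·log p
  have h0 : (padicValNat p (2 ^ (p - 1) - 1) : ℝ) * Real.log p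
      ≤ A * p / Real.log p + A' * Real.log p := by
    have hW := hY p hp hp2
    have hmul := mul_le_mul_of_nonneg_right hW hL.le
    have hid : (A * p / Real.log p ^ 2 + A') * Real.log p = A * p / Real.log p + A' * Real.log p := by
      field_simp
    linarith [hmul, hid]
  -- Step 1: A·p/log p ≤ (c/2)·p + A·P0/log 2
  have h1 : A * p / Real.log p ≤ c / 2 * p + A * P0 / Real.log 2 := by
    rcases le_or_gt (2 * A / c) (Real.log p) with hcase | hcase
    · -- log p ≥ 2A/c, so A/log p ≤ c/2
      have h2A : 2 * A ≤ c * Real.log p := by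
        have := (div_le_iff₀ hc).mp hcase
        linarith
      have hmain : A * p / Real.log p ≤ c / 2 * p := by
        rw [div_le_iff₀ hL]
        nlinarith [hp_pos, h2A]
      have : 0 ≤ A * P0 / Real.log 2 := by positivity
      linarith
    · -- log p < 2A/c, so p < P0 and A·p/log p ≤ A·P0/log 2
      have hpP0 : (p : ℝ) < P0 := by
        calc (p : ℝ) = Real.exp (Real.log p) := (Real.exp_log hp_pos).symm
          _ < Real.exp (2 * A / c) := Real.exp_lt_exp.mpr hcase
      have hmain : A * p / Real.log p ≤ A * P0 / Real.log 2 := by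
        rw [div_le_div_iff₀ hL hlog2]
        have h1' : A * p ≤ A * P0 := mul_le_mul_of_nonneg_left hpP0.le hA
        have h2' : A * p * Real.log 2 ≤ A * P0 * Real.log 2 :=
          mul_le_mul_of_nonneg_right h1' hlog2.le
        have h3' : A * P0 * Real.log 2 ≤ A * P0 * Real.log p :=
          mul_le_mul_of_nonneg_left hL2 (by positivity)
        linarith
      have : 0 ≤ c / 2 * p := by positivity
      linarith
  -- Step 2: A'·log p ≤ (c/2)·p + (A'+1)·(-1 - log d)
  have h2 : A' * Real.log p ≤ c / 2 * p + (A' + 1) * (-1 - Real.log d) := by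
    have hlogd : Real.log p = Real.log (d * p) - Real.log d := by
      rw [Real.log_mul hd.ne' hp_pos.ne']
      ring
    have hle : Real.log (d * p) ≤ d * p - 1 := Real.log_le_sub_one_of_pos (by positivity)
    have hA'L : A' * Real.log p ≤ (A' + 1) * Real.log p := by nlinarith [hL.le]
    have hstep : (A' + 1) * Real.log p ≤ (A' + 1) * (d * p - 1 - Real.log d) := by
      apply mul_le_mul_of_nonneg_left _ (by positivity)
      rw [hlogd]
      linarith
    have hd' : (A' + 1) * d = c / 2 := by
      rw [hd_def]
      field_simp
    calc A' * Real.log p ≤ (A' + 1) * (d * p - 1 - Real.log d) := le_trans hA'L hstep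
      _ = (A' + 1) * d * p + (A' + 1) * (-1 - Real.log d) := by ring
      _ = c / 2 * p + (A' + 1) * (-1 - Real.log d) := by rw [hd']
  -- Step 3: the index bound converts c·p into ε·e_p·log 2
  have h3 : c * p ≤ ε * (orderOf (2 : ZMod p) : ℝ) * Real.log 2 := by
    have hmul := mul_le_mul_of_nonneg_left hidx (by positivity : (0 : ℝ) ≤ ε * Real.log 2)
    have hcp : c * p = ε * Real.log 2 * p / I := by
      rw [hc_def]
      ring
    rw [hcp, div_le_iff₀ hI]
    nlinarith [hmul]
  -- combine
  calc (padicValNat p (2 ^ (p - 1) - 1) : ℝ) * Real.log p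
      ≤ A * p / Real.log p + A' * Real.log p := h0
    _ ≤ (c / 2 * p + A * P0 / Real.log 2) + (c / 2 * p + (A' + 1) * (-1 - Real.log d)) :=
      add_le_add h1 h2
    _ = c * p + (A * P0 / Real.log 2 + (A' + 1) * (-1 - Real.log d)) := by ring
    _ ≤ ε * (orderOf (2 : ZMod p) : ℝ) * Real.log 2
          + (A * P0 / Real.log 2 + (A' + 1) * (-1 - Real.log d)) := by linarith [h3]

/-- The same conclusion in the `(W(p) - 1)·log p` normalisation used by
`soloInformed_onePrime_of_abc` (natural-number subtraction, so it is implied by the previous bound). -/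
theorem soloInformed_onePrime_boundedIndex_pred_of_twoLogBound {A A' : ℝ} (hA : 0 ≤ A) (hA' : 0 ≤ A')
    (hY : ∀ p : ℕ, p.Prime → p ≠ 2 →
      (padicValNat p (2 ^ (p - 1) - 1) : ℝ) ≤ A * p / (Real.log p) ^ 2 + A')
    {I : ℝ} (hI : 0 < I) {ε : ℝ} (hε : 0 < ε) :
    ∃ K : ℝ, ∀ p : ℕ, p.Prime → p ≠ 2 → (p : ℝ) ≤ I * (orderOf (2 : ZMod p) : ℝ) →
      ((padicValNat p (2 ^ (p - 1) - 1) - 1 : ℕ) : ℝ) * Real.log p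
        ≤ ε * (orderOf (2 : ZMod p) : ℝ) * Real.log 2 + K := by
  obtain ⟨K, hK⟩ := soloInformed_onePrime_boundedIndex_of_twoLogBound hA hA' hY hI hε
  refine ⟨K, fun p hp hp2 hidx => le_trans ?_ (hK p hp hp2 hidx)⟩
  have hL : 0 ≤ Real.log p := Real.log_nonneg (by exact_mod_cast hp.one_lt.le)
  apply mul_le_mul_of_nonneg_right _ hL
  exact_mod_cast Nat.sub_le _ _

end Summit.ABC.ABC.Theorems
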